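import Summits.CriticalPhenomena.PercolationContinuityZ3.Theorems.Transplant.KNCells2SchemeO
import Summits.CriticalPhenomena.PercolationContinuityZ3.Theorems.Transplant.KNCells2Scheme
import Summits.CriticalPhenomena.PercolationContinuityZ3.Theorems.Transplant.KNCellsRunO
import Summits.CriticalPhenomena.PercolationContinuityZ3.Theorems.Transplant.KNCellsRun
import Summits.CriticalPhenomena.PercolationContinuityZ3.Theorems.Transplant.KNCellsSchemeO
import Summits.CriticalPhenomena.PercolationContinuityZ3.Theorems.Transplant.KNCellsProcessO
import Summits.CriticalPhenomena.PercolationContinuityZ3.Theorems.Transplant.KNCells2Run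
import Literature.Probability.Percolation.OrientedHistorySiteRenormalizationRun
import HarnessLib

/-!
# N2 (frames-only node `SamePDropOfSkeletonFrm₁`, OPEN) — ORIENTED MACRO LAYER (WAVE 0 (c1), (R-18) `q ≡ true`): the oriented twin of N1's `KNCells2Run`

builds on p205010 (kernel theorem, internal audit signed; external expert review pending) — nothing in this file uses p205010; NOTHING is claimed about the
open node `SamePDropOfSkeletonFrm₁` (`SamePDropOfSkeletonNeg₁` is CLOSED in the tree and untouched by this file).
Status sentence (coordinator 2026-08-20T04:30Z): "θ(p_c) = 0 on ℤ^d, all d ≥ 2 — kernel-verified (Lean 4/Mathlib, standard axioms); internal adversarial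
audit SIGNED 2026-08-20 04:29Z; external expert review pending."
Lane `prim-bschramm-*`, seat `prim-bschramm-stmt` (gen 19); helper file (`--supports stmt-CriticalPhenomena-4575 --as helper`); N2-SCOPE §20, (R-18)/(R-19).
PORT RULES (HOME/prim-bschramm-stmt-g19/lean/port_orient.py): the history-site API is replaced by its ORIENTED twin at the fixed quadrant `qNE := fun _ => true`
(`HState.choice ↦ HState.ochoice qNE`, `mstOf ↦ omstOf qNE`, `mst/stN ↦ omst/ostN qNE`, `occFinal ↦ ooccFinal qNE`, `Lawful ↦ OLawful qNE`, onward directions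
`onward ↦ onwardO` = the POSITIVE ones, (N2-e)); every declaration whose text changes thereby — directly or through a changed declaration — is re-declared with the
suffix `O` (same namespace); unchanged declarations of the N1 file are NOT repeated (the N1 module is imported). Docstrings/citations are N1's.
N1 HEADER (kept for the reader):
* `hst₂`, `oOf₂` (observation of the envelope), `dOf₂` (the stored entry anchor), `newR₂`; `stN_eq₂`, `next_cases₂`, `of_next_some₂`;
* `F_mono₂`, `V_mono₂` (with `F_cons_*`, `ξ_cons_*` of `KNCellsRun`), `step_none₂`, `hst_succ_of_some₂`, `probe_record₂`, `depB_read'`,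
  **`step_some₂`** (a probe along `e`: `F`, `ξ`, the macro-state; `arr (tgt e) := dep e.1`, `dep (tgt e) :=` the stored entry anchor),
  `anchors_step_of_ne₂`, `anchors_eq_of_det₂`.
[cite: KozmaNitzan2024, §4 pp. 26–27 (E_{i+1}, G_{i+1}) — the ℤ^d model] [cite: GrimmettPercolation1999, §7.2]
-/
noncomputable section

open MeasureTheory ProbabilityTheory
open scoped ENNReal Classical

namespace Summit.CriticalPhenomena.PercolationContinuityZ3.Theorems

namespace Transplant

namespace KNCells

open Literature.Probability.Percolation Literature.Probability.LatticeModels SimpleGraph GadgetSystem ProbeHistory HSiteScheme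
open Literature.Probability.Percolation.KozmaNitzan (opens opens_nil opens_cons_none opens_cons_some)

variable {V : Type*} [DecidableEq V]

namespace KSchA

variable {A : Type*} {G : SimpleGraph V} [G.LocallyFinite] (S : KSchA V A)

/-- The explorer of the scheme is `nextProbe₂O`. [folklore] -/
theorem scheme₂_nextO : (S.scheme₂O G).E.next = S.nextProbe₂O G := rfl

/-- The success criterion of the scheme is `succ₂'O`. [folklore] -/
theorem scheme₂_succO : (S.scheme₂O G).succ = S.succ₂'O G := rfl

/-- The initial edges of the scheme are `U₀`. [folklore] -/
theorem scheme₂_U₀O : (S.scheme₂O G).U₀ = S.U₀ G := rfl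

variable (G) in
/-- The history of the run after `n` steps. [folklore] -/
abbrev hst₂O (ω : BondConfig V) (n : ℕ) : ProbeHistory V := (S.scheme₂O G).E.hist n ω

variable (G) in
/-- The observation of the examination along `e` after `h` on `ω` (the open edges of the envelope). [folklore] -/
abbrev oOf₂O (ω : BondConfig V) (h : ProbeHistory V) (e : Site 2 × MDir) : Finset (Sym2 V) :=
  obs ω (S.env₂O G h e (S.aOf₁O G h e) (S.aOf₂O G h e))

variable (G) in
/-- The entry anchor stored for `tgt e` by the examination along `e` after `h` on `ω`. [folklore] -/
abbrev dOf₂O (ω : BondConfig V) (h : ProbeHistory V) (e : Site 2 × MDir) : A :=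
  S.depB G h e (S.aOf₁O G h e) (S.aOf₂O G h e) (S.oOf₂O G ω h e)

variable (G) in
/-- The new region revealed by the examination along `e` after `h` on `ω`. [folklore] -/
abbrev newR₂O (ω : BondConfig V) (h : ProbeHistory V) (e : Site 2 × MDir) : Finset V :=
  S.newRegionO G h e (S.aOf₁O G h e) (S.aOf₂O G h e) (S.oOf₂O G ω h e)

/-- The macro-state of the run is the macro part of the anchored replay of its history. [folklore] -/
theorem stN_eq₂O (n : ℕ) (ω : BondConfig V) : (S.scheme₂O G).ostN qNE n ω = (S.astOf₂O G (S.hst₂O G ω n)).st := S.mst_eq_astOf₂O _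

/-- **The three cases of a step**: no probe, or a valid history with a chosen edge, examined by the probe at the source's departure anchor.
[folklore] -/
theorem next_cases₂O (ω : BondConfig V) (n : ℕ) :
    (S.scheme₂O G).E.next (S.hst₂O G ω n) = none ∨
      ∃ e, ((S.scheme₂O G).ostN qNE n ω).ochoice qNE = some e ∧ S.Valid₂O G (S.hst₂O G ω n) e ∧
        (S.scheme₂O G).E.next (S.hst₂O G ω n) = some (S.probe₂O G (S.hst₂O G ω n) e (S.aOf₁O G (S.hst₂O G ω n) e) (S.aOf₂O G (S.hst₂O G ω n) e)) := by
  rw [scheme₂_nextO]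
  cases hP : S.nextProbe₂O G (S.hst₂O G ω n) with
  | none => exact Or.inl rfl
  | some P =>
    obtain ⟨e, hc, hV, rfl⟩ := S.nextProbe₂_eq_someO hP
    exact Or.inr ⟨e, by rw [stN_eq₂O]; exact hc, hV, rfl⟩

/-- If a probe is made then it is the examination of the chosen edge after a valid history. [folklore] -/
theorem of_next_some₂O {ω : BondConfig V} {n : ℕ} {P : AProbe V} (hP : (S.scheme₂O G).E.next (S.hst₂O G ω n) = some P) :
    ∃ e, ((S.scheme₂O G).ostN qNE n ω).ochoice qNE = some e ∧ S.Valid₂O G (S.hst₂O G ω n) e ∧ P = S.probe₂O G (S.hst₂O G ω n) e (S.aOf₁O G (S.hst₂O G ω n) e) (S.aOf₂O G (S.hst₂O G ω n) e) := by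
  rw [scheme₂_nextO] at hP
  obtain ⟨e, hc, hV, hPe⟩ := S.nextProbe₂_eq_someO hP
  exact ⟨e, by rw [stN_eq₂O]; exact hc, hV, hPe⟩

/-- `F` only grows along the run. [folklore] -/
theorem F_mono₂O (ω : BondConfig V) : Monotone fun n => S.F G (S.hst₂O G ω n) := by
  refine monotone_nat_of_le_succ fun n => ?_
  show S.F G (S.hst₂O G ω n) ⊆ S.F G (S.hst₂O G ω (n + 1))
  exact S.F_subset_cons _ _

/-- The explored region only grows along the run. [folklore] -/
theorem V_mono₂O (ω : BondConfig V) : Monotone fun n => S.Vx G (S.hst₂O G ω n) := fun _ _ hmn =>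
  vspan_mono (S.F_mono₂O ω hmn)

/-- No probe: `F`, `ξ`, the macro-state and the anchors are unchanged. [folklore] -/
theorem step_none₂O {ω : BondConfig V} {n : ℕ} (hD : (S.scheme₂O G).E.next (S.hst₂O G ω n) = none) :
    S.F G (S.hst₂O G ω (n + 1)) = S.F G (S.hst₂O G ω n) ∧ S.ξ G (S.hst₂O G ω (n + 1)) = S.ξ G (S.hst₂O G ω n) ∧
      (S.scheme₂O G).ostN qNE (n + 1) ω = (S.scheme₂O G).ostN qNE n ω ∧ S.astOf₂O G (S.hst₂O G ω (n + 1)) = S.astOf₂O G (S.hst₂O G ω n) := by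
  have h1 : S.hst₂O G ω (n + 1) = none :: S.hst₂O G ω n := by
    show (S.scheme₂O G).E.hist (n + 1) ω = _
    rw [AExplorer.hist_succ, (S.scheme₂O G).E.step_of_none hD]
  rw [h1, F_cons_none, ξ_cons_none, astOf₂_cons_noneO]
  exact ⟨rfl, rfl, (S.scheme₂O G).ostN_succ_of_next_none qNE hD, rfl⟩

/-- A probe along `e`: the history gains the probe's record. [folklore] -/
theorem hst_succ_of_some₂O {ω : BondConfig V} {n : ℕ} {e : Site 2 × MDir}
    (hD : (S.scheme₂O G).E.next (S.hst₂O G ω n) = some (S.probe₂O G (S.hst₂O G ω n) e (S.aOf₁O G (S.hst₂O G ω n) e) (S.aOf₂O G (S.hst₂O G ω n) e))) :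
    S.hst₂O G ω (n + 1) = some ((S.probe₂O G (S.hst₂O G ω n) e (S.aOf₁O G (S.hst₂O G ω n) e) (S.aOf₂O G (S.hst₂O G ω n) e)).record ω) :: S.hst₂O G ω n := by
  show (S.scheme₂O G).E.hist (n + 1) ω = _
  rw [AExplorer.hist_succ, (S.scheme₂O G).E.step_of_some hD]

/-- The record of the examination: revealed edges `revealOf₂O … (oOf₂O)` and observation `obs ω` of them. [folklore] -/
theorem probe_record₂O (ω : BondConfig V) (h : ProbeHistory V) (e : Site 2 × MDir) :
    (S.probe₂O G h e (S.aOf₁O G h e) (S.aOf₂O G h e)).record ω =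
      (S.revealOf₂O G h e (S.aOf₁O G h e) (S.aOf₂O G h e) (S.oOf₂O G ω h e),
        obs ω (S.revealOf₂O G h e (S.aOf₁O G h e) (S.aOf₂O G h e) (S.oOf₂O G ω h e))) := rfl

/-- The stored entry anchor read off the probe's observation is the one read off the envelope's observation. [folklore] -/
theorem depB_read'O (ω : BondConfig V) (h : ProbeHistory V) (e : Site 2 × MDir) :
    S.depB G h e (S.aOf₁O G h e) (S.aOf₂O G h e) ((S.probe₂O G h e (S.aOf₁O G h e) (S.aOf₂O G h e)).read ω) = S.dOf₂O G ω h e :=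
  S.depB_readO h e _ _ ω

/-- A probe along `e`: `F` gains the revealed edges, `ξ` the observed ones, the macro-state is updated by the success of the examination,
the target's arrival anchor becomes the source's departure anchor and its departure anchor the one read off the observation; all other
anchors are unchanged. [cite: KozmaNitzan2024, §4 p. 27 (E_{i+1}, G_{i+1}, X_{i+1})] -/
theorem step_some₂O {ω : BondConfig V} {n : ℕ} {e : Site 2 × MDir} (hc : ((S.scheme₂O G).ostN qNE n ω).ochoice qNE = some e)
    (hD : (S.scheme₂O G).E.next (S.hst₂O G ω n) = some (S.probe₂O G (S.hst₂O G ω n) e (S.aOf₁O G (S.hst₂O G ω n) e) (S.aOf₂O G (S.hst₂O G ω n) e))) :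
    S.F G (S.hst₂O G ω (n + 1)) = S.F G (S.hst₂O G ω n) ∪ S.revealOf₂O G (S.hst₂O G ω n) e (S.aOf₁O G (S.hst₂O G ω n) e) (S.aOf₂O G (S.hst₂O G ω n) e) (S.oOf₂O G ω (S.hst₂O G ω n) e) ∧
      S.ξ G (S.hst₂O G ω (n + 1)) = S.ξ G (S.hst₂O G ω n) ∪
        obs ω (S.revealOf₂O G (S.hst₂O G ω n) e (S.aOf₁O G (S.hst₂O G ω n) e) (S.aOf₂O G (S.hst₂O G ω n) e) (S.oOf₂O G ω (S.hst₂O G ω n) e)) ∧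
      (S.scheme₂O G).ostN qNE (n + 1) ω = ((S.scheme₂O G).ostN qNE n ω).update e
        (S.succ₂'O G (S.hst₂O G ω n) e ((S.probe₂O G (S.hst₂O G ω n) e (S.aOf₁O G (S.hst₂O G ω n) e) (S.aOf₂O G (S.hst₂O G ω n) e)).read ω)) ∧
      (S.astOf₂O G (S.hst₂O G ω (n + 1))).arr = Function.update (S.astOf₂O G (S.hst₂O G ω n)).arr (tgt e) (S.aOf₂O G (S.hst₂O G ω n) e) ∧
      (S.astOf₂O G (S.hst₂O G ω (n + 1))).dep = Function.update (S.astOf₂O G (S.hst₂O G ω n)).dep (tgt e) (S.dOf₂O G ω (S.hst₂O G ω n) e) := by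
  have h1 := S.hst_succ_of_some₂O hD
  have hc' : (S.astOf₂O G (S.hst₂O G ω n)).st.ochoice qNE = some e := by rw [← stN_eq₂O]; exact hc
  refine ⟨by rw [h1, F_cons_some]; rfl, by rw [h1, ξ_cons_some]; rfl, ?_, ?_, ?_⟩
  · rw [(S.scheme₂O G).ostN_succ_of_next_some qNE hD, hc]
    rfl
  · rw [h1, astOf₂_cons_someO, hc']
  · rw [h1, astOf₂_cons_someO, hc']
    exact congrArg (Function.update (S.astOf₂O G (S.hst₂O G ω n)).dep (tgt e)) (S.depB_read'O ω _ e)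

/-- A probe along `e` does not change the anchors of macro-vertices other than the target. [folklore] -/
theorem anchors_step_of_ne₂O {ω : BondConfig V} {n : ℕ} {e : Site 2 × MDir} (hc : ((S.scheme₂O G).ostN qNE n ω).ochoice qNE = some e)
    (hD : (S.scheme₂O G).E.next (S.hst₂O G ω n) = some (S.probe₂O G (S.hst₂O G ω n) e (S.aOf₁O G (S.hst₂O G ω n) e) (S.aOf₂O G (S.hst₂O G ω n) e))) {x : Site 2} (hx : x ≠ tgt e) :
    (S.astOf₂O G (S.hst₂O G ω (n + 1))).arr x = (S.astOf₂O G (S.hst₂O G ω n)).arr x ∧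
      (S.astOf₂O G (S.hst₂O G ω (n + 1))).dep x = (S.astOf₂O G (S.hst₂O G ω n)).dep x := by
  obtain ⟨-, -, -, harr, hdep⟩ := S.step_some₂O hc hD
  rw [harr, hdep, Function.update_of_ne hx, Function.update_of_ne hx]
  exact ⟨rfl, rfl⟩

/-- **Anchors of determined macro-vertices are frozen**: a determined vertex is never a target again. [folklore] -/
theorem anchors_eq_of_det₂O {ω : BondConfig V} {m : ℕ} {x : Site 2} (hx : ((S.scheme₂O G).ostN qNE m ω).Det x) :
    ∀ {n}, m ≤ n → (S.astOf₂O G (S.hst₂O G ω n)).arr x = (S.astOf₂O G (S.hst₂O G ω m)).arr x ∧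
      (S.astOf₂O G (S.hst₂O G ω n)).dep x = (S.astOf₂O G (S.hst₂O G ω m)).dep x := by
  intro n hmn
  induction n with
  | zero =>
    obtain rfl : m = 0 := Nat.le_zero.1 hmn
    exact ⟨rfl, rfl⟩
  | succ n ih =>
    rcases Nat.of_le_succ hmn with hle | rfl
    · obtain ⟨ih1, ih2⟩ := ih hle
      rcases S.next_cases₂O (G := G) ω n with hD | ⟨e, hc, -, hD⟩
      · obtain ⟨-, -, -, hast⟩ := S.step_none₂O hD
        rw [hast]; exact ⟨ih1, ih2⟩
      · have hne : x ≠ tgt e := fun h =>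
          (HState.cand_of_ochoice hc).2 (h ▸ (S.scheme₂O G).det_ostN_mono qNE ω hle hx)
        obtain ⟨h1, h2⟩ := S.anchors_step_of_ne₂O hc hD hne
        rw [h1, h2]; exact ⟨ih1, ih2⟩
    · exact ⟨rfl, rfl⟩

end KSchA

end KNCells

end Transplant

end Summit.CriticalPhenomena.PercolationContinuityZ3.Theorems

end
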